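import Literature.NumberTheory.EllipticCurves.PointDivisibility
import Literature.NumberTheory.EllipticCurves.DivisionPolynomialTorsion
import HarnessLib

/-!
# `[n] : E(K̄) → E(K̄)` is onto: discharge of `zsmul_geomPoints_surjective`

Trunk T-ELLARITH; discharges the named fact `WeierstrassCurve.zsmul_geomPoints_surjective` of
`Literature.NumberTheory.EllipticCurves.PointDivisibility` (Silverman, *AEC*, §VIII.2 with
Prop. III.4.2(a) and Thm. II.2.3: for an elliptic curve `E/K` and `m ≠ 0`, multiplication by `m`
is surjective on `E(K̄)`, i.e. `0 → E[m] → E(K̄) → E(K̄) → 0` is exact), which serves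
`WeierstrassCurve.exists_kummerMap` (the Kummer sequence). Everything here is proved.

Silverman's proof (`[m]` is a non-constant morphism of the smooth projective curve `E`, and such a
morphism is surjective, II.2.3) rests on the theory of curves and function fields, absent from
Mathlib; the elementary alternative through Exercise 3.7 (`x([m]P) = φₘ(P)/ψₘ(P)²`) needs the
multiplication formula for division polynomials, also absent. The proof below is elementary and
self-contained on top of Mathlib's group law and of the *generic multiplication polynomials*
`(Xₙ, Yₙ, Zₙ) = WeierstrassCurve.smulPoly V n` of `DivisionPolynomialTorsion` (iterated chord–tangent
formulas in Jacobian coordinates, correct at every affine point `P` with `kP ≠ O` for `1 ≤ k ≤ n`,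
"generic"; the non-generic points form a finite set `B`, by the finiteness of torsion proved there).

## The argument (`K` algebraically closed, `E/K` elliptic, `n ≥ 1`)

Let `S ⊆ K` be the set of abscissae `x(nP)` of the non-zero `n`-th multiples. Since `-(nP) = n(-P)`
has the same abscissa, `[n]` is onto iff `S = K`.
1. *If some `a ∉ S` then `K ∖ S` is infinite* (`infinite_setOf_not_nsmul`): for a point
   `R` with `x(R) = a`, the coset `R + nE(K)` misses `nE(K)` (two affine points with the same
   abscissa are equal or opposite), so `x(R + nE(K)) ⊆ K ∖ S`; and `nE(K)` is infinite because
   `E(K)` is (`infinite_point`) and `[n]` has finite fibres (`E[n]` is finite).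
2. *`K ∖ S` is finite* (`finite_setOf_not_nsmul`). For `a ∈ K` put `g_a = Xₙ - a Zₙ² ∈ K[E]`. At a
   generic point `P`, `Zₙ(P) ≠ 0` and `x(nP) = Xₙ(P)/Zₙ(P)²`, so a generic zero of `g_a` shows
   `a ∈ S`; hence for `a ∉ S` all zeros of `g_a` on `E` lie in `B`, and all roots of the norm
   `N(g_a) = N_{K[E]/K[x]}(g_a) ∈ K[x]` lie in the finite set `x(B)` (a root `x₀` of the norm lifts
   to a zero `(x₀, y₀)` of `g_a` on the curve: `N(g)(x₀) = g(x₀, y₀) g(x₀, y₀')` for the two points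
   above `x₀`, `eval_norm_mk`). Now `N(g_a) = F₀ + aF₁ + a²F₂` is quadratic in `a`
   (Mathlib's `norm_smul_basis`), of bounded degree, and never `0` (if `g_a ≡ 0` on `E` then
   `x(nP) = a` for every generic `P`, making `nE(K)` finite). If `K ∖ S` were infinite, by
   pigeonhole three distinct `a₁, a₂, a₃ ∉ S` would give norms with the same multiset of roots,
   i.e. `N(g_{aᵢ}) = cᵢ M` for one monic `M` with roots in `x(B)`; by Lagrange interpolation in `a`,
   `N(g_a) ∈ K·M` for *every* `a`. But a generic `P = (x, y)` with `x ∉ x(B)` (all but finitely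
   many points) is a zero of `g_a` for `a = Xₙ(P)/Zₙ(P)²`, so `x` is a root of `N(g_a) = cM`,
   `c ≠ 0`, i.e. `x ∈ x(B)` — a contradiction.
3. Hence `S = K` (`nsmul_surjective_of_isAlgClosed`, `zsmul_surjective_of_isAlgClosed`), and, for
   `K = F̄`, the named fact holds (`zsmul_geomPoints_surjective_holds`).

## References

* [SilvermanAEC2009] J. H. Silverman, *The Arithmetic of Elliptic Curves*, 2nd ed., GTM 106,
  Springer 2009, doi:10.1007/978-0-387-09494-6: §VIII.2 (first display: the sequence
  `0 → E[m] → E(K̄) →[m] E(K̄) → 0`), Prop. III.4.2(a), Thm. II.2.3, Group Law Algorithm III.2.3.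

## Design

* Deliberate dot-notation extensions in `namespace WeierstrassCurve`, with a generic
  `[DecidableEq K]` as in `DivisionPolynomialTorsion`; the final discharge is stated under
  `open scoped Classical`, the convention of `GaloisAction`/`PointDivisibility`, so that `n • Q` is
  literally the one of `geomPoints.instAddCommGroup`.
* No auxiliary definitions (a pure proof file): the abscissa of a point and the set `S` are
  spelled out (`∃ y h, n • P = (a, y)`).
-/

noncomputable section

open Polynomial
open scoped Polynomial.Bivariate AddSubgroup

universe u

namespace WeierstrassCurve

variable {K : Type u} [Field K] (V : WeierstrassCurve K)

/-! ## Points with prescribed abscissa -/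

/-- The affine points whose abscissa lies in a finite set form a finite set (at most two points
above each `x`). [folklore] -/
theorem finite_setOf_X_mem {F : Set K} (hF : F.Finite) :
    {P : V.toAffine.Point | ∃ x y : K, ∃ h : V.toAffine.Nonsingular x y,
      P = .some x y h ∧ x ∈ F}.Finite := by
  classical
  set qx : K → K[X] := fun x => V.toAffine.polynomial.map (evalRingHom x) with hqx
  have hq0 : ∀ x, qx x ≠ 0 := fun x => (V.toAffine.monic_polynomial.map _).ne_zero
  set T : Set (K × K) := {xy | xy.1 ∈ F ∧ (qx xy.1).IsRoot xy.2} with hT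
  have hTfin : T.Finite := by
    refine (hF.biUnion fun x _ => (finite_setOf_isRoot (hq0 x)).image (Prod.mk x)).subset ?_
    rintro ⟨x, y⟩ ⟨hx, hy⟩
    exact Set.mem_biUnion hx ⟨y, hy, rfl⟩
  let f : K × K → V.toAffine.Point := fun xy =>
    if h : V.toAffine.Nonsingular xy.1 xy.2 then .some xy.1 xy.2 h else 0
  refine (hTfin.image f).subset ?_
  rintro P ⟨x, y, h, rfl, hPx⟩
  refine ⟨(x, y), ⟨hPx, ?_⟩, ?_⟩
  · change (qx x).IsRoot y
    rw [IsRoot.def, hqx, map_evalRingHom_eval]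
    exact h.left
  · simp only [f, dif_pos h]

/-! ## The norm of a function on the curve, evaluated -/

/-- **The norm detects zeros.** For `g ∈ K[X][Y]` and a point `(x₀, y₀)` of the curve, the norm
`N_{K[E]/K[X]}(g) ∈ K[X]` evaluates at `x₀` to `g(x₀, y₀) · g(x₀, y₀')`, where
`y₀' = -y₀ - a₁x₀ - a₃` is the ordinate of the other point above `x₀` (write `g ≡ p + qY`; then
`N = p² - pq(a₁X + a₃) - q²(X³ + a₂X² + a₄X + a₆)`, Mathlib's `norm_smul_basis`, and
`y₀ + y₀' = -(a₁x₀ + a₃)`, `y₀y₀' = -(x₀³ + a₂x₀² + a₄x₀ + a₆)`). Silverman, *AEC*, II.§2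
(norms of functions under `x : E → ℙ¹`). [folklore] -/
theorem eval_norm_mk {g : K[X][Y]} {x₀ y₀ : K} (hxy : V.toAffine.Equation x₀ y₀) :
    (Algebra.norm K[X] (Affine.CoordinateRing.mk V g)).eval x₀ =
      g.evalEval x₀ y₀ * g.evalEval x₀ (V.toAffine.negY x₀ y₀) := by
  obtain ⟨p, q, hpq⟩ :=
    Affine.CoordinateRing.exists_smul_basis_eq (Affine.CoordinateRing.mk V g)
  -- `g ≡ p + qY` modulo the Weierstrass polynomial
  have hdvd : V.toAffine.polynomial ∣ g - (C p + C q * Y) := by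
    rw [← AdjoinRoot.mk_eq_mk]
    change Affine.CoordinateRing.mk V g = Affine.CoordinateRing.mk V _
    rw [← hpq, map_add, map_mul, Affine.CoordinateRing.smul, Affine.CoordinateRing.smul, mul_one]
  have hev : ∀ {x y : K}, V.toAffine.Equation x y → g.evalEval x y = p.eval x + q.eval x * y := by
    intro x y h
    have e := evalEval_dvd x y hdvd
    have h' : V.toAffine.polynomial.evalEval x y = 0 := h
    rw [h', zero_dvd_iff, evalEval_sub, sub_eq_zero, evalEval_add, evalEval_mul, evalEval_C,
      evalEval_C, evalEval_X] at e
    exact e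
  rw [← hpq, Affine.CoordinateRing.norm_smul_basis, hev hxy,
    hev ((Affine.equation_neg x₀ y₀).mpr hxy)]
  have heq := (Affine.equation_iff ..).mp hxy
  simp only [eval_sub, eval_mul, eval_pow, eval_add, eval_C, eval_X, Affine.negY]
  linear_combination (q.eval x₀) ^ 2 * heq

/-- If `g` vanishes at a point `(x₀, y₀)` of the curve then `x₀` is a root of its norm. [folklore] -/
theorem isRoot_norm_mk_of_evalEval_eq_zero {g : K[X][Y]} {x₀ y₀ : K}
    (hxy : V.toAffine.Equation x₀ y₀) (hg : g.evalEval x₀ y₀ = 0) :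
    (Algebra.norm K[X] (Affine.CoordinateRing.mk V g)).IsRoot x₀ := by
  rw [IsRoot.def, V.eval_norm_mk hxy, hg, zero_mul]

/-- Over an algebraically closed field, a root `x₀` of the norm of `g` is the abscissa of a zero of
`g` on the curve. [folklore] -/
theorem exists_evalEval_eq_zero_of_isRoot_norm_mk [IsAlgClosed K] {g : K[X][Y]} {x₀ : K}
    (hx : (Algebra.norm K[X] (Affine.CoordinateRing.mk V g)).IsRoot x₀) :
    ∃ y₀, V.toAffine.Equation x₀ y₀ ∧ g.evalEval x₀ y₀ = 0 := by
  obtain ⟨y₀, hy₀⟩ := V.exists_equation x₀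
  rw [IsRoot.def, V.eval_norm_mk hy₀] at hx
  rcases mul_eq_zero.mp hx with h | h
  · exact ⟨y₀, hy₀, h⟩
  · exact ⟨_, (Affine.equation_neg x₀ y₀).mpr hy₀, h⟩

/-- A function that is zero in the coordinate ring vanishes at every point of the curve.
[folklore] -/
theorem evalEval_eq_zero_of_mk_eq_zero {g : K[X][Y]} (h0 : Affine.CoordinateRing.mk V g = 0)
    {x y : K} (h : V.toAffine.Equation x y) : g.evalEval x y = 0 := by
  obtain ⟨r, hr⟩ := AdjoinRoot.mk_eq_zero.mp h0
  have hxy : V.toAffine.polynomial.evalEval x y = 0 := h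
  rw [hr, evalEval_mul, hxy, zero_mul]

variable [DecidableEq K]

/-! ## Fibres of `[n]` -/

/-- The fibres of `P ↦ n • P` (`n ≠ 0`) on an elliptic curve over an algebraically closed field are
finite (cosets of the finite group `E[n]`). Silverman, *AEC*, Cor. III.6.4. [folklore] -/
theorem finite_setOf_nsmul_eq [IsAlgClosed K] [V.IsElliptic] {n : ℕ} (hn : n ≠ 0)
    (Q : V.toAffine.Point) : {P : V.toAffine.Point | n • P = Q}.Finite := by
  by_cases hex : ∃ P₀ : V.toAffine.Point, n • P₀ = Q
  · obtain ⟨P₀, hP₀⟩ := hex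
    haveI := V.finite_torsionBy_of_isAlgClosed (n := (n : ℤ)) (Int.natCast_ne_zero.mpr hn)
    refine ((Set.toFinite (V.toAffine.Point[(n : ℤ)] : Set V.toAffine.Point)).image
      fun T => T + P₀).subset ?_
    intro P hP
    refine ⟨P - P₀, ?_, sub_add_cancel P P₀⟩
    change P - P₀ ∈ V.toAffine.Point[(n : ℤ)]
    rw [Literature.NumberTheory.EllipticCurves.mem_torsionBy_iff, natCast_zsmul, smul_sub, hP₀, sub_eq_zero]
    exact hP
  · convert Set.finite_empty
    ext P
    exact ⟨fun hP => hex ⟨P, hP⟩, fun h => h.elim⟩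

/-- The image under `[n]` (`n ≠ 0`) of an infinite set of points is infinite. [folklore] -/
theorem infinite_image_nsmul [IsAlgClosed K] [V.IsElliptic] {n : ℕ} (hn : n ≠ 0)
    {s : Set V.toAffine.Point} (hs : s.Infinite) :
    ((fun P : V.toAffine.Point => n • P) '' s).Infinite := by
  intro hfin
  refine hs ((hfin.preimage' fun Q _ => ?_).subset (Set.subset_preimage_image _ s))
  exact V.finite_setOf_nsmul_eq hn Q

/-! ## Multiplication by `n` at generic points -/

/-- **`n • P` at a generic point, from the generic multiplication polynomials.** If `P = (x, y)`
satisfies `k • P ≠ O` for `1 ≤ k ≤ n` (`n ≥ 1`), then `Zₙ(x, y) ≠ 0`, and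
`n • P = (Xₙ(x, y)/Zₙ(x, y)², Yₙ(x, y)/Zₙ(x, y)³)`; in particular `x(n • P) = Xₙ(x, y)/Zₙ(x, y)²`.
(`Jacobian.nonsingular_smulXYZ`, `evalEval_smulPoly`.) Silverman, *AEC*, III.2.3. [folklore] -/
theorem nsmul_some_eq_of_generic {n : ℕ} (hn : 1 ≤ n) {x y : K} (h : V.toAffine.Nonsingular x y)
    (hgen : ∀ k : ℕ, 1 ≤ k → k ≤ n → k • (Affine.Point.some x y h : V.toAffine.Point) ≠ 0) :
    (V.smulPoly n 2).evalEval x y ≠ 0 ∧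
      ∃ h', n • (Affine.Point.some x y h : V.toAffine.Point) =
        .some ((V.smulPoly n 0).evalEval x y / (V.smulPoly n 2).evalEval x y ^ 2)
          ((V.smulPoly n 1).evalEval x y / (V.smulPoly n 2).evalEval x y ^ 3) h' := by
  have hP : Jacobian.Nonsingular V ![x, y, 1] := (Jacobian.nonsingular_some x y).mpr h
  have hto : Jacobian.Point.toAffine V ![x, y, 1] = Affine.Point.some x y h :=
    Jacobian.Point.toAffine_some hP
  have hgen' : ∀ k : ℕ, 2 ≤ k → k + 2 ≤ n → k • Jacobian.Point.toAffine V ![x, y, 1] ≠ 0 := by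
    intro k hk2 hkn
    rw [hto]
    exact hgen k (by omega) (by omega)
  obtain ⟨hns, hto'⟩ := Jacobian.nonsingular_smulXYZ hP one_ne_zero n hgen'
  rw [hto] at hto'
  have hZ : Jacobian.smulXYZ V ![x, y, 1] n 2 ≠ 0 := by
    intro hZ
    refine hgen n hn le_rfl ?_
    rw [← hto', Jacobian.Point.toAffine_of_Z_eq_zero hZ]
  refine ⟨by rwa [evalEval_smulPoly_apply], ?_⟩
  have hns' := (Jacobian.nonsingular_of_Z_ne_zero hZ).mp hns
  refine ⟨by simpa only [evalEval_smulPoly_apply] using hns', ?_⟩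
  rw [← hto', Jacobian.Point.toAffine_of_Z_ne_zero hns hZ]
  simp only [evalEval_smulPoly_apply]

/-! ## The set of abscissae of `n`-th multiples -/

/-- **Step 1.** If some abscissa `a` is not that of an `n`-th multiple, then infinitely many are
not: the coset `R + nE(K)` of a point `R` above `a` misses `nE(K)`, is infinite, and consists of
affine points whose abscissae are not those of `n`-th multiples. [folklore] -/
theorem infinite_setOf_not_nsmul [IsAlgClosed K] [V.IsElliptic] {n : ℕ} (hn : n ≠ 0) {a : K}
    (ha : ¬ ∃ (P : V.toAffine.Point) (y : K) (h : V.toAffine.Nonsingular a y),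
      n • P = .some a y h) :
    {a' : K | ¬ ∃ (P : V.toAffine.Point) (y : K) (h : V.toAffine.Nonsingular a' y),
      n • P = .some a' y h}.Infinite := by
  intro hfin
  obtain ⟨b, hb⟩ := V.exists_equation a
  have hR : V.toAffine.Nonsingular a b := Affine.equation_iff_nonsingular.mp hb
  set R : V.toAffine.Point := Affine.Point.some a b hR with hRdef
  have hwit : ∀ {P : V.toAffine.Point}, n • P = R → False := fun {P} hP => ha ⟨P, b, hR, hP⟩
  -- every `R + n • P` is an affine point whose abscissa is not that of an `n`-th multiple
  have hsub : (fun P : V.toAffine.Point => R + n • P) '' Set.univ ⊆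
      {Q : V.toAffine.Point | ∃ x y : K, ∃ h : V.toAffine.Nonsingular x y, Q = .some x y h ∧
        x ∈ {a' : K | ¬ ∃ (P : V.toAffine.Point) (y : K) (h : V.toAffine.Nonsingular a' y),
          n • P = .some a' y h}} := by
    rintro _ ⟨P, -, rfl⟩
    dsimp only
    rcases hQ : R + n • P with _ | ⟨x', y', h'⟩
    · refine (hwit (P := -P) ?_).elim
      rw [smul_neg]
      exact (eq_neg_iff_add_eq_zero.mpr hQ).symm
    · refine ⟨x', y', h', rfl, ?_⟩
      rintro ⟨P', y'', h'', hP'⟩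
      rcases Affine.Point.X_eq_iff.mp (rfl : x' = x') with e | e
      · refine hwit (P := P' - P) ?_
        rw [smul_sub, hP', ← e, ← hQ, add_sub_cancel_right]
      · refine hwit (P := -P' - P) ?_
        rw [smul_sub, smul_neg, hP', ← neg_eq_iff_eq_neg.mpr e, neg_neg, ← hQ,
          add_sub_cancel_right]
  have hinf : ((fun P : V.toAffine.Point => R + n • P) '' Set.univ).Infinite := by
    haveI := V.infinite_point
    have e : (fun P : V.toAffine.Point => R + n • P) '' Set.univ =
        (fun Q => R + Q) '' ((fun P : V.toAffine.Point => n • P) '' Set.univ) := by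
      rw [Set.image_image]
    rw [e]
    exact (V.infinite_image_nsmul hn Set.infinite_univ).image (add_right_injective R).injOn
  exact hinf ((V.finite_setOf_X_mem hfin).subset hsub)

/-- **Step 2.** All but finitely many abscissae are abscissae of `n`-th multiples (`n ≥ 1`); see
the module docstring for the argument (norms of `g_a = Xₙ - aZₙ²`, pigeonhole on their roots,
Lagrange interpolation in `a`). [folklore] -/
theorem finite_setOf_not_nsmul [IsAlgClosed K] [V.IsElliptic] {n : ℕ} (hn : 1 ≤ n) :
    {a : K | ¬ ∃ (P : V.toAffine.Point) (y : K) (h : V.toAffine.Nonsingular a y),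
      n • P = .some a y h}.Finite := by
  by_contra hinf
  set S : Set K := {a : K | ∃ (P : V.toAffine.Point) (y : K) (h : V.toAffine.Nonsingular a y),
      n • P = .some a y h} with hS
  replace hinf : {a : K | a ∉ S}.Infinite := hinf
  haveI := V.infinite_point
  have hns : ∀ {x y : K}, V.toAffine.Equation x y → V.toAffine.Nonsingular x y := fun h =>
    Affine.equation_iff_nonsingular.mp h
  -- the finite set of non-generic points and the finite set of their abscissae
  set Bad : Set V.toAffine.Point :=
    ⋃ k ∈ Set.Icc 1 n, (V.toAffine.Point[(k : ℤ)] : Set V.toAffine.Point) with hBad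
  have hBadfin : Bad.Finite := by
    refine Set.Finite.biUnion (Set.finite_Icc 1 n) fun k hk => ?_
    haveI := V.finite_torsionBy_of_isAlgClosed (n := (k : ℤ))
      (Int.natCast_ne_zero.mpr (by rw [Set.mem_Icc] at hk; omega))
    exact Set.toFinite _
  have hgen : ∀ {P : V.toAffine.Point}, P ∉ Bad → ∀ k : ℕ, 1 ≤ k → k ≤ n → k • P ≠ 0 := by
    intro P hP k hk1 hkn hk0
    refine hP (Set.mem_biUnion (Set.mem_Icc.mpr ⟨hk1, hkn⟩) ?_)
    change P ∈ V.toAffine.Point[(k : ℤ)]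
    rw [Literature.NumberTheory.EllipticCurves.mem_torsionBy_iff, natCast_zsmul]
    exact hk0
  have hBad0 : (0 : V.toAffine.Point) ∈ Bad := by
    refine Set.mem_biUnion (Set.mem_Icc.mpr ⟨le_rfl, hn⟩) ?_
    change (0 : V.toAffine.Point) ∈ V.toAffine.Point[((1 : ℕ) : ℤ)]
    rw [Literature.NumberTheory.EllipticCurves.mem_torsionBy_iff]
    exact smul_zero _
  set F : Set K := ⋃ P ∈ Bad, {x : K | ∃ (y : K) (h : V.toAffine.Nonsingular x y),
      P = Affine.Point.some x y h} with hF
  have hFfin : F.Finite := by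
    refine hBadfin.biUnion fun P _ => Set.Subsingleton.finite ?_
    rintro x ⟨y, h, rfl⟩ x' ⟨y', h', e⟩
    exact (Affine.Point.some.inj e).left
  have hmemF : ∀ {x y : K} (h : V.toAffine.Nonsingular x y), Affine.Point.some x y h ∈ Bad →
      x ∈ F := fun {x y} h hB => Set.mem_biUnion hB ⟨y, h, rfl⟩
  -- the functions `g_a = Xₙ - a Zₙ²` on the curve
  set Xn : K[X][Y] := V.smulPoly n 0 with hXn
  set Zn : K[X][Y] := V.smulPoly n 2 with hZn
  set g : K → K[X][Y] := fun a => Xn - C (C a) * Zn ^ 2 with hg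
  have hgev : ∀ a x y : K, (g a).evalEval x y = Xn.evalEval x y - a * Zn.evalEval x y ^ 2 := by
    intro a x y
    simp only [hg, evalEval_sub, evalEval_mul, evalEval_C, eval_C, evalEval_pow]
  -- generic points: `Zₙ ≠ 0` and `nP = (Xₙ/Zₙ², Yₙ/Zₙ³)`
  have key : ∀ {x y : K} (h : V.toAffine.Nonsingular x y), Affine.Point.some x y h ∉ Bad →
      Zn.evalEval x y ≠ 0 ∧ ∃ h', n • (Affine.Point.some x y h : V.toAffine.Point) =
        .some (Xn.evalEval x y / Zn.evalEval x y ^ 2)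
          ((V.smulPoly n 1).evalEval x y / Zn.evalEval x y ^ 3) h' :=
    fun {x y} h hPB => V.nsmul_some_eq_of_generic hn h (hgen hPB)
  -- (i) for `a ∉ S`, every zero of `g_a` on the curve is a non-generic point
  have hzero : ∀ {a : K}, a ∉ S → ∀ {x y : K} (h : V.toAffine.Nonsingular x y),
      (g a).evalEval x y = 0 → Affine.Point.some x y h ∈ Bad := by
    intro a ha x y h h0
    by_contra hPB
    obtain ⟨hZ, h', hnP⟩ := key h hPB
    rw [hgev, sub_eq_zero, ← div_eq_iff (pow_ne_zero 2 hZ)] at h0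
    subst h0
    exact ha ⟨_, _, h', hnP⟩
  -- (ii) `g_a ≢ 0` on the curve, for every `a`
  have hgne : ∀ a : K, Affine.CoordinateRing.mk V (g a) ≠ 0 := by
    intro a h0
    have himage : (fun P : V.toAffine.Point => n • P) '' Badᶜ ⊆
        {Q : V.toAffine.Point | ∃ x y : K, ∃ h : V.toAffine.Nonsingular x y,
          Q = .some x y h ∧ x ∈ ({a} : Set K)} := by
      rintro _ ⟨P, hPB, rfl⟩
      rcases P with _ | ⟨x, y, h⟩
      · exact (hPB (by rw [← Affine.Point.zero_def]; exact hBad0)).elim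
      · obtain ⟨hZ, h', hnP⟩ := key h hPB
        refine ⟨_, _, h', hnP, ?_⟩
        rw [Set.mem_singleton_iff, div_eq_iff (pow_ne_zero 2 hZ)]
        have e := V.evalEval_eq_zero_of_mk_eq_zero h0 h.left
        rw [hgev, sub_eq_zero] at e
        exact e
    exact V.infinite_image_nsmul (by omega) hBadfin.infinite_compl
      ((V.finite_setOf_X_mem (Set.finite_singleton a)).subset himage)
  -- the norms `N_a ∈ K[X]`: nonzero, quadratic in `a`, of bounded degree
  set N : K → K[X] := fun a => Algebra.norm K[X] (Affine.CoordinateRing.mk V (g a)) with hN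
  have hN0 : ∀ a, N a ≠ 0 := fun a =>
    (Algebra.norm_ne_zero_iff_of_basis (Affine.CoordinateRing.basis V)).mpr (hgne a)
  obtain ⟨F₀, F₁, F₂, hNF⟩ : ∃ F₀ F₁ F₂ : K[X], ∀ a, N a = F₀ + C a * F₁ + C a ^ 2 * F₂ := by
    obtain ⟨p, q, hpq⟩ :=
      Affine.CoordinateRing.exists_smul_basis_eq (Affine.CoordinateRing.mk V Xn)
    obtain ⟨r, s, hrs⟩ :=
      Affine.CoordinateRing.exists_smul_basis_eq (Affine.CoordinateRing.mk V (Zn ^ 2))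
    have hga : ∀ a, Affine.CoordinateRing.mk V (g a) =
        (p - C a * r) • (1 : V.toAffine.CoordinateRing) +
          (q - C a * s) • Affine.CoordinateRing.mk V Y := by
      intro a
      have e : Affine.CoordinateRing.mk V (Xn - C (C a) * Zn ^ 2) =
          (p • (1 : V.toAffine.CoordinateRing) + q • Affine.CoordinateRing.mk V Y) -
            C a • (r • (1 : V.toAffine.CoordinateRing) + s • Affine.CoordinateRing.mk V Y) := by
        rw [map_sub, map_mul, ← hpq, ← hrs, Affine.CoordinateRing.smul (C a)]
      change Affine.CoordinateRing.mk V (Xn - C (C a) * Zn ^ 2) = _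
      rw [e, smul_add, ← mul_smul, ← mul_smul, sub_smul, sub_smul]
      abel
    refine ⟨p ^ 2 - p * q * (C V.a₁ * X + C V.a₃) -
        q ^ 2 * (X ^ 3 + C V.a₂ * X ^ 2 + C V.a₄ * X + C V.a₆),
      -(2 * p * r) + (p * s + q * r) * (C V.a₁ * X + C V.a₃) +
        2 * q * s * (X ^ 3 + C V.a₂ * X ^ 2 + C V.a₄ * X + C V.a₆),
      r ^ 2 - r * s * (C V.a₁ * X + C V.a₃) -
        s ^ 2 * (X ^ 3 + C V.a₂ * X ^ 2 + C V.a₄ * X + C V.a₆), fun a => ?_⟩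
    change Algebra.norm K[X] (Affine.CoordinateRing.mk V (g a)) = _
    rw [hga a, Affine.CoordinateRing.norm_smul_basis]
    ring
  set D : ℕ := max F₀.natDegree (max F₁.natDegree F₂.natDegree) with hD
  have hdeg : ∀ a, (N a).natDegree ≤ D := by
    intro a
    rw [hNF a]
    refine (natDegree_add_le _ _).trans (max_le ((natDegree_add_le _ _).trans (max_le ?_ ?_)) ?_)
    · exact le_max_left _ _
    · exact (natDegree_C_mul_le a F₁).trans (le_max_of_le_right (le_max_left _ _))
    · rw [← C_pow]
      exact (natDegree_C_mul_le _ F₂).trans (le_max_of_le_right (le_max_right _ _))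
  -- for `a ∉ S` the roots of `N_a` lie in `F`
  have hroots : ∀ {a : K}, a ∉ S → ∀ x₀ ∈ (N a).roots, x₀ ∈ F := by
    intro a ha x₀ hx₀
    rw [mem_roots (hN0 a)] at hx₀
    obtain ⟨y₀, hy₀, h0⟩ := V.exists_evalEval_eq_zero_of_isRoot_norm_mk hx₀
    exact hmemF (hns hy₀) (hzero ha (hns hy₀) h0)
  -- pigeonhole: the multisets of roots of the `N_a`, `a ∉ S`, range over a finite set
  set Fm : Multiset K := hFfin.toFinset.val with hFm
  have hpat : ∀ {a : K}, a ∉ S → (N a).roots ≤ D • Fm := by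
    intro a ha
    rw [Multiset.le_iff_count]
    intro x
    rw [Multiset.count_nsmul]
    by_cases hx : x ∈ (N a).roots
    · have hxF : x ∈ Fm := Finset.mem_val.mpr (hFfin.mem_toFinset.mpr (hroots ha x hx))
      rw [Multiset.count_eq_one_of_mem hFfin.toFinset.nodup hxF, mul_one]
      exact (Multiset.count_le_card x _).trans ((card_roots' (N a)).trans (hdeg a))
    · rw [Multiset.count_eq_zero.mpr hx]
      exact Nat.zero_le _
  obtain ⟨m, hm⟩ : ∃ m : Multiset K, {a | a ∉ S ∧ (N a).roots = m}.Infinite := by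
    by_contra hall
    simp only [not_exists, Set.not_infinite] at hall
    apply hinf
    refine (((Multiset.powerset (D • Fm)).toFinset.finite_toSet).biUnion fun m _ => hall m).subset ?_
    intro a ha
    refine Set.mem_biUnion (x := (N a).roots) ?_ ⟨ha, rfl⟩
    rw [Finset.mem_coe, Multiset.mem_toFinset, Multiset.mem_powerset]
    exact hpat ha
  obtain ⟨a₁, ha₁S, hr₁⟩ := hm.nonempty
  obtain ⟨a₂, ⟨ha₂S, hr₂⟩, h21⟩ := (hm.sdiff (Set.finite_singleton a₁)).nonempty
  obtain ⟨a₃, ⟨⟨ha₃S, hr₃⟩, h31⟩, h32⟩ :=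
    ((hm.sdiff (Set.finite_singleton a₁)).sdiff (Set.finite_singleton a₂)).nonempty
  rw [Set.mem_singleton_iff] at h21 h31 h32
  -- the common monic part `M` of `N_{a₁}, N_{a₂}, N_{a₃}`
  set M : K[X] := (m.map fun r => X - C r).prod with hM
  have hNM : ∀ {a : K}, (N a).roots = m → N a = C (N a).leadingCoeff * M := by
    intro a hr
    have e := C_leadingCoeff_mul_prod_multiset_X_sub_C
      (IsAlgClosed.card_roots_eq_natDegree (p := N a))
    rw [hr] at e
    exact e.symm
  -- Lagrange interpolation: `N_a ∈ K·M` for every `a`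
  have hlin : ∀ a : K, ∃ c : K, N a = C c * M := by
    intro a
    obtain ⟨c₁, hc₁⟩ : ∃ c : K, c = (N a₁).leadingCoeff := ⟨_, rfl⟩
    obtain ⟨c₂, hc₂⟩ : ∃ c : K, c = (N a₂).leadingCoeff := ⟨_, rfl⟩
    obtain ⟨c₃, hc₃⟩ : ∃ c : K, c = (N a₃).leadingCoeff := ⟨_, rfl⟩
    have h₁ := hNM hr₁
    have h₂ := hNM hr₂
    have h₃ := hNM hr₃
    rw [← hc₁] at h₁
    rw [← hc₂] at h₂
    rw [← hc₃] at h₃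
    rw [hNF] at h₁ h₂ h₃
    have h12 : a₁ - a₂ ≠ 0 := sub_ne_zero.mpr (Ne.symm h21)
    have h13 : a₁ - a₃ ≠ 0 := sub_ne_zero.mpr (Ne.symm h31)
    have h23 : a₂ - a₃ ≠ 0 := sub_ne_zero.mpr (Ne.symm h32)
    have h21' : a₂ - a₁ ≠ 0 := sub_ne_zero.mpr h21
    have h31' : a₃ - a₁ ≠ 0 := sub_ne_zero.mpr h31
    have h32' : a₃ - a₂ ≠ 0 := sub_ne_zero.mpr h32
    obtain ⟨ℓ₁, hℓ₁⟩ : ∃ ℓ : K, ℓ = (a - a₂) * (a - a₃) / ((a₁ - a₂) * (a₁ - a₃)) := ⟨_, rfl⟩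
    obtain ⟨ℓ₂, hℓ₂⟩ : ∃ ℓ : K, ℓ = (a - a₁) * (a - a₃) / ((a₂ - a₁) * (a₂ - a₃)) := ⟨_, rfl⟩
    obtain ⟨ℓ₃, hℓ₃⟩ : ∃ ℓ : K, ℓ = (a - a₁) * (a - a₂) / ((a₃ - a₁) * (a₃ - a₂)) := ⟨_, rfl⟩
    have e0 : ℓ₁ + ℓ₂ + ℓ₃ = 1 := by
      rw [hℓ₁, hℓ₂, hℓ₃]
      field_simp
      ring
    have e1 : ℓ₁ * a₁ + ℓ₂ * a₂ + ℓ₃ * a₃ = a := by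
      rw [hℓ₁, hℓ₂, hℓ₃]
      field_simp
      ring
    have e2 : ℓ₁ * a₁ ^ 2 + ℓ₂ * a₂ ^ 2 + ℓ₃ * a₃ ^ 2 = a ^ 2 := by
      rw [hℓ₁, hℓ₂, hℓ₃]
      field_simp
      ring
    have e0' := congrArg C e0
    have e1' := congrArg C e1
    have e2' := congrArg C e2
    simp only [map_add, map_mul, map_pow, map_one] at e0' e1' e2'
    refine ⟨ℓ₁ * c₁ + ℓ₂ * c₂ + ℓ₃ * c₃, ?_⟩
    rw [hNF]
    simp only [map_add, map_mul]
    linear_combination C ℓ₁ * h₁ + C ℓ₂ * h₂ + C ℓ₃ * h₃ - F₀ * e0' - F₁ * e1' - F₂ * e2'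
  -- a generic point whose abscissa is not in `F` yields the contradiction
  obtain ⟨P, hP⟩ := ((hBadfin.union (V.finite_setOf_X_mem hFfin)).infinite_compl).nonempty
  rw [Set.mem_compl_iff, Set.mem_union, not_or] at hP
  obtain ⟨hPB, hPF⟩ := hP
  rcases P with _ | ⟨x, y, h⟩
  · exact hPB (by rw [← Affine.Point.zero_def]; exact hBad0)
  · have hxF : x ∉ F := fun hx => hPF ⟨x, y, h, rfl, hx⟩
    obtain ⟨hZ, -⟩ := key h hPB
    obtain ⟨a, ha⟩ : ∃ a : K, a = Xn.evalEval x y / Zn.evalEval x y ^ 2 := ⟨_, rfl⟩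
    have hga0 : (g a).evalEval x y = 0 := by
      rw [hgev, ha, div_mul_cancel₀ _ (pow_ne_zero 2 hZ), sub_self]
    have hNa : (N a).IsRoot x := V.isRoot_norm_mk_of_evalEval_eq_zero h.left hga0
    obtain ⟨c, hc⟩ := hlin a
    have hc0 : c ≠ 0 := by
      rintro rfl
      exact hN0 a (by rw [hc, map_zero, zero_mul])
    have hMx : M.IsRoot x := by
      rw [hc, IsRoot.def, eval_mul, eval_C] at hNa
      exact (mul_eq_zero.mp hNa).resolve_left hc0
    have hM0 : M ≠ 0 :=
      (monic_multiset_prod_of_monic _ _ fun r _ => monic_X_sub_C r).ne_zero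
    have hxm : x ∈ m := by
      have e := (mem_roots hM0).mpr hMx
      rwa [hM, roots_multiset_prod_X_sub_C] at e
    rw [← hr₁] at hxm
    exact hxF (hroots ha₁S x hxm)

/-- **Multiplication by `n ≠ 0` is surjective on the points of an elliptic curve over an
algebraically closed field** (Silverman, *AEC*, §VIII.2 with Prop. III.4.2(a) and Thm. II.2.3;
here by the elementary argument of the module docstring). [cite: SilvermanAEC2009, §VIII.2 (sequence 0 → E[m] → E(K̄) → E(K̄) → 0), Prop. III.4.2(a), Thm. II.2.3] -/
theorem nsmul_surjective_of_isAlgClosed [IsAlgClosed K] [V.IsElliptic] {n : ℕ} (hn : n ≠ 0) :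
    Function.Surjective fun P : V.toAffine.Point => n • P := by
  have hS : ∀ a : K, ∃ (P : V.toAffine.Point) (y : K) (h : V.toAffine.Nonsingular a y),
      n • P = .some a y h := fun a => by
    by_contra ha
    exact V.infinite_setOf_not_nsmul hn ha (V.finite_setOf_not_nsmul (Nat.one_le_iff_ne_zero.mpr hn))
  intro Q
  rcases Q with _ | ⟨a, b, h⟩
  · exact ⟨0, by change n • (0 : V.toAffine.Point) = 0; exact smul_zero _⟩
  · obtain ⟨P, y, h', hP⟩ := hS a
    rcases Affine.Point.X_eq_iff.mp (rfl : a = a) with e | e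
    · exact ⟨P, by change n • P = _; rw [hP]; exact e⟩
    · exact ⟨-P, by change n • -P = _; rw [smul_neg, hP, e, neg_neg]⟩

/-- **Multiplication by an integer `n ≠ 0` is surjective on `E(K)`, `K` algebraically closed.**
Silverman, *AEC*, §VIII.2, Prop. III.4.2(a), Thm. II.2.3. [cite: SilvermanAEC2009, §VIII.2 (sequence 0 → E[m] → E(K̄) → E(K̄) → 0), Prop. III.4.2(a), Thm. II.2.3] -/
theorem zsmul_surjective_of_isAlgClosed [IsAlgClosed K] [V.IsElliptic] {n : ℤ} (hn : n ≠ 0) :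
    Function.Surjective fun P : V.toAffine.Point => n • P := by
  intro Q
  rcases Int.natAbs_eq n with h | h
  · obtain ⟨P, hP⟩ := V.nsmul_surjective_of_isAlgClosed (Int.natAbs_ne_zero.mpr hn) Q
    exact ⟨P, by change n • P = Q; rw [h, natCast_zsmul]; exact hP⟩
  · obtain ⟨P, hP⟩ := V.nsmul_surjective_of_isAlgClosed (Int.natAbs_ne_zero.mpr hn) Q
    exact ⟨-P, by change n • -P = Q; rw [h, neg_zsmul, zsmul_neg, neg_neg, natCast_zsmul]; exact hP⟩

end WeierstrassCurve

/-! ## Discharge of the named fact -/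

namespace WeierstrassCurve

open scoped Classical

variable {F : Type u} [Field F] (W : WeierstrassCurve F)

/-- **Discharge of `zsmul_geomPoints_surjective`** (Silverman, AEC, §VIII.2 with Prop. III.4.2(a)
and Thm. II.2.3): for an elliptic curve `W/F` and `n ≠ 0`, `Q ↦ n • Q` is onto on
`geomPoints W = E(F̄)` (`zsmul_surjective_of_isAlgClosed` for `W/F̄`).
[cite: SilvermanAEC2009, §VIII.2 (sequence 0 → E[m] → E(K̄) → E(K̄) → 0), Prop. III.4.2(a), Thm. II.2.3] -/
theorem zsmul_geomPoints_surjective_holds : W.zsmul_geomPoints_surjective := by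
  intro _ n hn
  exact (W.baseChange (AlgebraicClosure F)).zsmul_surjective_of_isAlgClosed hn

end WeierstrassCurve
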